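import Mathlib
import HarnessLib
import Summits.ValiantsHypothesis.ValiantsHypothesis.Theorems.LacunarySymmetroidMatrixDescartesProductPlusOneBalanceCount

/-!
# ValiantsHypothesis / LacunarySymmetroid — crux `MatrixDescartes` (stmt-ValiantsHypothesis-18050, V1),
# LINE (A) «product_plus_one», floor `OneChangeFloorK3`: the LATE-SWITCHING SECTOR is LINEAR at EVERY support ratio

A new EVERY-RATIO sector of the floor's c-free Euler count, in the stub's own shape (`Z₊(eulerNumerator d a 0) ≤ 2m + 1`, cf. the tame
sector's `2m + 2` at ratio `≤ 4`, ✓ `eulerBound_tame`, and the coherent sector's `2m + 2` at every ratio, ✓ `eulerBound_coherent`).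

By ✓ `…BalanceZone` / ✓ `…BalanceCount`, an incoherent no-dip row `(+,−,−)` (`p = d₁−d₀`, `q = d₂−d₀`) is `Ψ`-monotone (bottom weight)
wherever it is unswitched OR top-dominated, `(q−3p)·a₁a₂ ≤ p·a₂²·x^{q−p}`.  Call the row LATE-SWITCHING if it is still unswitched at every
height where it is NOT top-dominated (i.e. its zero lies beyond its balance point `x^{q−p} = (q−3p)|a₁|/(p|a₂|)`; a WEAK-MIDDLE-LETTER
condition, implied by `p^q·|a₀|^{q−p}·|a₂|^p ≥ (q−2p)^{q−p}(q−3p)^p·|a₁|^q`).  Then the per-row criterion holds at EVERY `x > 0`, so: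

* ★★ `eulerBound_lateSwitching` — a NO-DIP company (`a_{j0} a_{j2} < 0`, degenerate middle letters allowed) on ANY support
  `d 0 < d 1 < d 2`, bottom coupling, every incoherent row late-switching (pointwise form: `p·a₂²·x^{d₂−d₁} < (q−3p)·a₁a₂ ⇒ a₂·f_j(x) < 0`)
  ⇒ `Z₊(eulerNumerator d a 0) ≤ 2m + 1` — LINEAR IN `m`, NO RATIO WINDOW.  Coherent rows need nothing; at ratio `q ≤ 3p` the hypothesis is
  empty and the theorem is the tame count.
* `lateSwitching_sector_class` — member currency: every `c·X^{m d₀} + ∏ f_j` of the sector has `Z₊ ≤ 2m + 2` (✓ `card_pos_roots_class_le_euler`).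

So at ratio `> 4` the floor's open core shrinks to companies containing an incoherent row that switches INSIDE OR BEFORE its balance zone.
HONEST FRAMING: a sector of the research floor; NOT `OneChangeFloorK3` / `stub_eulerBoundK3` / `stub_classRowK3` / `stub_polyLaw` /
`MatrixDescartes`; `VP ≠ VNP` is NOT proved.  No definitions, no named facts; Mathlib + the lane files.
-/

set_option linter.dupNamespace false

namespace Summit.ValiantsHypothesis.ValiantsHypothesis.Theorems.LacunarySymmetroidMatrixDescartes

namespace ProductPlusOne

open Polynomial Finset
open scoped BigOperators

/-- ★★ **THE LATE-SWITCHING SECTOR IS LINEAR AT EVERY RATIO.**  `K = 3`, bottom coupling, ANY support `d 0 < d 1 < d 2`, any `m`; a no-dip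
company (`a_{j0} a_{j2} < 0`) in which every INCOHERENT row (`a_{j0} a_{j1} < 0`) is unswitched wherever it is not top-dominated:
`(d₁−d₀)·a_{j2}²·x^{d₂−d₁} < (d₂−d₀−3(d₁−d₀))·a_{j1}a_{j2} ⇒ a_{j2}·f_j(x) < 0` (`x > 0`).  Then `Z₊(eulerNumerator d a 0) ≤ 2m + 1`.
[this file's theorem] -/
theorem eulerBound_lateSwitching {m : ℕ} (d : Fin 3 → ℕ) (h01 : d 0 < d 1) (h12 : d 1 < d 2)
    (a : Fin m → Fin 3 → ℝ) (hac : ∀ j, a j 0 * a j 2 < 0)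
    (hlate : ∀ j, a j 0 * a j 1 < 0 → ∀ x : ℝ, 0 < x →
      ((d 1 : ℝ) - d 0) * a j 2 ^ 2 * x ^ (d 2 - d 1) < (((d 2 : ℝ) - d 0) - 3 * ((d 1 : ℝ) - d 0)) * (a j 1 * a j 2) →
      a j 2 * (∑ l, C (a j l) * X ^ (d l) : ℝ[X]).eval x < 0) :
    ((∑ j, (∑ l, C (a j l * ((d l : ℝ) - d 0)) * X ^ (d l)) * ∏ i ∈ Finset.univ.erase j, (∑ l, C (a i l) * X ^ (d l))
        : ℝ[X]).roots.toFinset.filter (fun t => 0 < t)).card ≤ 2 * m + 1 := by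
  classical
  rcases Nat.eq_zero_or_pos m with hm | hm
  · subst hm
    simp only [Finset.univ_eq_empty, Finset.sum_empty, roots_zero, Multiset.toFinset_zero, Finset.filter_empty,
      Finset.card_empty]
    exact Nat.zero_le _
  obtain ⟨e, he⟩ : ∃ e, d 1 = d 0 + e + 1 := ⟨d 1 - d 0 - 1, by omega⟩
  obtain ⟨k, hk⟩ : ∃ k, d 2 = d 0 + e + k + 2 := ⟨d 2 - d 1 - 1, by omega⟩
  have hk1 : d 2 - d 1 = k + 1 := by omega
  have hp : ((d 1 : ℝ) - d 0) = (e + 1 : ℝ) := by rw [he]; push_cast; ring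
  have hq : ((d 2 : ℝ) - d 0) = (e + k + 2 : ℝ) := by rw [hk]; push_cast; ring
  rw [eulerNumerator_eq d e k he hk a 0, sub_self, mul_zero, map_zero, zero_mul, sub_zero, card_pos_roots_X_pow_mul]
  set P : ℝ[X] := ∏ j, (C (a j 0) + C (a j 1) * X ^ (e + 1) + C (a j 2) * X ^ (e + k + 2)) with hPdef
  have hac' : ∀ j, a j 0 * a j 2 < 0 := hac
  have hP0 : P ≠ 0 := prod_trinomial_ne_zero (fun j => a j 0) (fun j => a j 1) (fun j => a j 2) e k hac'
  have hZ := prod_trinomial_pos_roots_le (fun j => a j 0) (fun j => a j 1) (fun j => a j 2) e k hac'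
  -- the per-row criterion holds at every `x > 0`
  have hrow : ∀ t : ℝ, 0 < t → ∀ j, a j 0 + a j 1 * t ^ (e + 1) + a j 2 * t ^ (e + k + 2) ≠ 0 →
      a j 2 * (a j 0 + a j 1 * t ^ (e + 1) + a j 2 * t ^ (e + k + 2)) < 0 ∨
      (a j 0 * a j 2 < 0 ∧ (0 ≤ a j 0 * a j 1 ∨ k ≤ 3 * e + 2 ∨
        ((e + k + 2 : ℝ) - 3 * (e + 1 : ℝ)) * (a j 1 * a j 2) ≤ (e + 1 : ℝ) * a j 2 ^ 2 * t ^ (k + 1) ∨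
        (e + k + 2 : ℝ) * ((e + k + 2 : ℝ) - 3 * (e + 1 : ℝ)) * (a j 1 * a j 2) * t ^ (k + 1) ≤ (e + 1 : ℝ) ^ 2 * a j 1 ^ 2)) := by
    intro t ht j _
    rcases le_or_gt 0 (a j 0 * a j 1) with hab | hab
    · exact Or.inr ⟨hac' j, Or.inl hab⟩
    · rcases le_or_gt (((e + k + 2 : ℝ) - 3 * (e + 1 : ℝ)) * (a j 1 * a j 2)) ((e + 1 : ℝ) * a j 2 ^ 2 * t ^ (k + 1)) with hdom | hdom
      · exact Or.inr ⟨hac' j, Or.inr (Or.inr (Or.inl hdom))⟩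
      · left
        have h := hlate j hab t ht (by rw [hp, hq, hk1]; exact hdom)
        rw [eval_row_eq_pow_mul d e k he hk (a j) t, mul_left_comm] at h
        exact neg_of_mul_neg_right h (pow_pos ht _).le
  have h := roots_filter_le_of_windowLaw P (X * derivative P) hP0 (fun t => 0 < t)
    (fun z₁ _ t h₁ _ h₂ _ => h₁.trans_le h₂) m hZ (fun w₁ w₂ hw₁ _ hw hfree h1 h2 => ?_)
  · exact h.trans (by omega)
  · have hfree' : ∀ t ∈ Set.Icc w₁ w₂, ∀ j, a j 0 + a j 1 * t ^ (e + 1) + a j 2 * t ^ (e + k + 2) ≠ 0 := by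
      intro t ht j hj
      apply hfree t ht
      rw [hPdef, eval_prod_trinomial, Finset.prod_eq_zero_iff]
      exact ⟨j, mem_univ _, hj⟩
    exact X_mul_derivative_no_two_zeros_of_rows' hm (fun j => a j 0) (fun j => a j 1) (fun j => a j 2) e k hw₁ hw hfree'
      (fun t ht j => hrow t (hw₁.trans_le ht.1) j (hfree' t ht j)) h1 h2

/-- **The late-switching sector in MEMBER currency:** every member `c·X^{m d 0} + ∏_j f_j` of the sector has at most `2m + 2` positive zeros
(✓ `card_pos_roots_class_le_euler`: the members' positive zeros are interlaced by those of the c-free Euler numerator). [this file's theorem] -/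
theorem lateSwitching_sector_class {m : ℕ} (d : Fin 3 → ℕ) (h01 : d 0 < d 1) (h12 : d 1 < d 2)
    (a : Fin m → Fin 3 → ℝ) (hac : ∀ j, a j 0 * a j 2 < 0)
    (hlate : ∀ j, a j 0 * a j 1 < 0 → ∀ x : ℝ, 0 < x →
      ((d 1 : ℝ) - d 0) * a j 2 ^ 2 * x ^ (d 2 - d 1) < (((d 2 : ℝ) - d 0) - 3 * ((d 1 : ℝ) - d 0)) * (a j 1 * a j 2) →
      a j 2 * (∑ l, C (a j l) * X ^ (d l) : ℝ[X]).eval x < 0) (c : ℝ) :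
    ((C c * X ^ (m * d 0) + ∏ j, (∑ l, C (a j l) * X ^ (d l)) : ℝ[X]).roots.toFinset.filter (fun t => 0 < t)).card
      ≤ 2 * m + 2 := by
  have h1 := card_pos_roots_class_le_euler d a 0 c
  have h2 := eulerBound_lateSwitching d h01 h12 a hac hlate
  omega

end ProductPlusOne

end Summit.ValiantsHypothesis.ValiantsHypothesis.Theorems.LacunarySymmetroidMatrixDescartes
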